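import Summits.ABC.ABC.Theorems.TwoSixPencilPencilBoundEngine
import Summits.ABC.ABC.Theses.RationalCuspPencil
import HarnessLib

/-!
# Crux `PencilFourBound` (stmt-ABC-24549, route `RationalCuspPencil`) — THE PENCIL ENGINE at `k = 4`, proved

`Summits/ABC/ABC/Theorems/RationalCuspPencilPencilFourBound.lean`: the route decl
`Summit.ABC.ABC.Theses.RationalCuspPencil.PencilFourBound` — for fixed nonzero integers
`a₃, b₃, a₄, b₄` with `a₃b₄ ≠ a₄b₃` and every `ε > 0` there is `C` with
`log max(|u|,|w|) ≤ C · rad(u·w·(a₃u+b₃w)·(a₄u+b₄w))^{1/4+ε}` for all coprime `u, w` with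
`u w (a₃u+b₃w)(a₄u+b₄w) ≠ 0` — is the instance `k = 4`, `a = (1, 0, a₃, a₄)`,
`b = (0, 1, b₃, b₄)` of the general pencil theorem
`Summit.ABC.ABC.Theorems.pencil_log_height_le_rad_rpow` (file `TwoSixPencilPencilBoundEngine.lean`,
= crux `TwoSixPencil.PencilBound`, stmt-ABC-24782): the four forms `u, w, a₃u+b₃w, a₄u+b₄w`
are pairwise non-proportional iff `a₃b₃a₄b₄ ≠ 0` and `a₃b₄ ≠ a₄b₃`, and `Fin.prod_univ_four`
identifies the products. Serves the classes ℤ/6 (forms `u, w, u+w, 9u+w`), ℤ/8 and ℤ/10, ℤ/2×ℤ/4,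
ℤ/2×ℤ/8 (route docstring).

HONESTY: corollary of the PROVED `stewartYu2001_thm2_holds`; the class theorem it serves
(`SixTorsionClassEpsShape`: Szpiro exponent `1/4` on the ℤ/6-torsion class) is an ε-column /
Szpiro-by-class RECORD — NOT abc, NOT A-PS (polynomial Szpiro), NOT rung A1′; the route reaches
`ABC` only through its DECLARED RESIDUAL `SixTorsionResidual`. [cite: StewartYu2001, Theorem 2]
-/

set_option linter.dupNamespace false

namespace Summit.ABC.ABC.Theorems

/-- **Crux `PencilFourBound` (stmt-ABC-24549) of route `RationalCuspPencil` — THE PENCIL ENGINE at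
`k = 4`, proved** as the instance `a = (1, 0, a₃, a₄)`, `b = (0, 1, b₃, b₄)` of the general pencil
theorem `pencil_log_height_le_rad_rpow` (forms `u, w, a₃u + b₃w, a₄u + b₄w`; pairwise
non-proportional iff `a₃ b₃ a₄ b₄ ≠ 0` and `a₃b₄ ≠ a₄b₃`). Serves the ℤ/6, ℤ/8, ℤ/10, ℤ/2×ℤ/4,
ℤ/2×ℤ/8 classes. NOT abc, NOT A-PS, NOT A1′. [cite: StewartYu2001, Theorem 2 and the remark after it] -/
theorem pencilFourBound_proof : Summit.ABC.ABC.Theses.RationalCuspPencil.PencilFourBound := by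
  unfold Summit.ABC.ABC.Theses.RationalCuspPencil.PencilFourBound
  intro a₃ b₃ a₄ b₄ ha₃ hb₃ ha₄ hb₄ hD ε hε
  have ha₃' : (0 : ℤ) ≠ a₃ := fun h => ha₃ h.symm
  have hb₃' : (0 : ℤ) ≠ b₃ := fun h => hb₃ h.symm
  have ha₄' : (0 : ℤ) ≠ a₄ := fun h => ha₄ h.symm
  have hb₄' : (0 : ℤ) ≠ b₄ := fun h => hb₄ h.symm
  have hD' : a₄ * b₃ ≠ a₃ * b₄ := fun h => hD h.symm
  have hab : ∀ i j : Fin 4, i ≠ j →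
      (![1, 0, a₃, a₄] i) * (![0, 1, b₃, b₄] j) ≠ (![1, 0, a₃, a₄] j) * (![0, 1, b₃, b₄] i) := by
    intro i j hij
    fin_cases i <;> fin_cases j <;> simp_all [mul_comm]
  obtain ⟨C, hC⟩ :=
    pencil_log_height_le_rad_rpow 4 ![1, 0, a₃, a₄] ![0, 1, b₃, b₄] (by norm_num) hab ε hε
  refine ⟨C, fun u w huw h0 => ?_⟩
  have hprod : ∏ i : Fin 4, ((![1, 0, a₃, a₄] i) * u + (![0, 1, b₃, b₄] i) * w) =
      u * w * (a₃ * u + b₃ * w) * (a₄ * u + b₄ * w) := by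
    rw [Fin.prod_univ_four]
    simp
  have h := hC u w huw (by rw [hprod]; exact h0)
  rw [hprod] at h
  have h4 : (1 / ((4 : ℕ) : ℝ) + ε) = (1 / 4 + ε : ℝ) := by norm_num
  rw [h4] at h
  exact h

end Summit.ABC.ABC.Theorems
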